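import Literature.Geometry.Riemannian.ChangGurskyYangProofs
import Literature.Geometry.Riemannian.CurvatureNormSq
import Literature.Geometry.Lorentzian.RicciNormSq
import HarnessLib

/-!
# Chang–Gursky–Yang 2003: regularity of the pointwise curvature quantities `|W|²`, `|E|²`, `σ₂(A)`
# and the integrals `∫|W|² dV`, `∫σ₂(A) dV` as honest Bochner integrals

Companion of `ChangGurskyYangProofs.lean` (kept separate so that its import cone — the intrinsic
square norm `|Rm|²` of `CurvatureNormSq.lean` and `‖Ric‖²` of `Lorentzian/RicciNormSq.lean` — does
not burden the importers of the Proofs file). Everything is PROVED; no definition, no named fact.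

The pointwise norms of `WeylEnergy.lean` / `ChangGurskyYangProofs.lean` (`weylNormSq`,
`tracelessRicciNormSq`, `sigma2WeylSchouten`) are defined as suprema over orthonormal frames of the
frame expressions; their regularity ("continuity of `|W|²` … not proved here", `WeylEnergy.lean`)
is established here by identifying them with intrinsic smooth quantities:

* `ricciNormSqFrame_eq_normSq` — `Σ_{ab} Ric(e_a,e_b)² = |Ric|²_g` (metric square norm `normSq`
  of `MetricNormSq.lean`) in an orthonormal basis; `curvNormSqFrame_eq_of_isOrthonormalFrame`,
  `curvNormSqFrame_eq_curvNormSqWith` — `Σ_{ijkl} Rm(eᵢ,eⱼ,e_k,e_l)² = |Rm|²_g`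
  (`curvNormSqWith`, Topping 2006, (3.2.4), `CurvatureNormSq.lean`), read in the chart at the
  point (`curvNormSqWith_chartInv_eq'`, `rmNormSqAt_eq_sum_sq`, `chartRep_riemAt_eq_curvatureForm`);
* `continuous_curvNormSqWith` — `|Rm|²_g` is continuous (smooth coordinate expression
  `IsMetricOn.contDiffOn_rmNormSqAt` on chart domains);
* `weylNormSq_eq_curvNormSqWith` (`|W|² = |Rm|² − 2|Ric|² + S²/3`, Besse 1987, (1.116)–1.117),
  `tracelessRicciNormSq_eq_normSq` (`|E|² = |Ric|² − S²/4`), hence `continuous_weylNormSq`,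
  `continuous_tracelessRicciNormSq`, `continuous_sigma2WeylSchouten` for a Riemannian `C^∞`
  metric on a `4`-dimensional model (`contMDiff_normSq_ricci'`, `contMDiff_scalarCurvature`);
* on a closed manifold: `weylEnergy_eq_ofReal_integral` (`|W|²` integrable and
  `g.weylEnergy = ENNReal.ofReal (∫|W|² dV)`), `integrable_sigma2WeylSchouten`, and
  `quarter_weylEnergy_lt_sigma2WeylSchoutenIntegral_iff` — hypothesis (ii) of Thm. 1.4 / (1.2) of
  Chang–Gursky–Yang 2003 in the shape used by `hThm14` of the reduction theorems,
  `¼(∫|W|²).toReal < ∫σ₂(A)`, is the printed single integral condition `0 < ∫(σ₂(A) − ¼|W|²) dV`.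

## References

* S.-Y. A. Chang, M. J. Gursky, P. C. Yang, *A conformally invariant sphere theorem in four
  dimensions*, Publ. Math. IHÉS 98 (2003), (0.2), (1.0)–(1.2), Thm. 1.4. [ChangGurskyYang2003]
* A. L. Besse, *Einstein Manifolds* (1987), (1.116)–1.117. [Besse1987]
* P. Topping, *Lectures on the Ricci flow*, LMS LNS 325 (2006), §3.2, (3.2.4). [Topping2006]
* B. O'Neill, *Semi-Riemannian geometry* (1983), Ch. 3, pp. 60–61. [ONeill1983]
-/

noncomputable section

open Bundle Finset Module MeasureTheory Set Filter
open scoped Manifold ContDiff Topology ENNReal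

namespace Literature.Geometry.Riemannian

/-! ### Regularity: `|Rm|²`, `|Ric|²`, `|E|²`, `|W|²` and `σ₂(A)` are continuous functions on `M` -/

section Regularity

open Literature.Geometry.Lorentzian (PseudoRiemannianMetric riemannianMeasure)
open Literature.Geometry.Lorentzian.PseudoRiemannianMetric
open Literature.Geometry.Lorentzian

variable {E : Type*} [NormedAddCommGroup E] [NormedSpace ℝ E] {H : Type*} [TopologicalSpace H]
  {I : ModelWithCorners ℝ E H} {M : Type*} [TopologicalSpace M] [ChartedSpace H M]
  [IsManifold I ∞ M]
  (g : PseudoRiemannianMetric I ∞ E (TangentSpace I : M → Type _))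
  [FiniteDimensional ℝ E] [g.HasLeviCivita]

/-- **`Σ_{ab} Ric(e_a,e_b)² = |Ric|²_g`** in an orthonormal basis: the frame expression
`ricciNormSqFrame` is the metric square norm `normSq` of the Ricci form (`MetricNormSq.lean`,
`normSq_eq_sum_sq` with `g(eᵢ,eᵢ) = 1`). [folklore] -/
theorem _root_.Literature.Geometry.Lorentzian.PseudoRiemannianMetric.ricciNormSqFrame_eq_normSq
    {x : M} {ι : Type*} [Fintype ι] [DecidableEq ι] {e : ι → TangentSpace I x}
    (he : g.IsOrthonormalFrame x e) (hι : Fintype.card ι = finrank ℝ E) :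
    g.ricciNormSqFrame x e = g.normSq x (g.ricci x) := by
  have hO : (g.toBilinForm x).IsOrthoᵢ (he.toBasis hι) := by
    intro i j hij
    rw [he.coe_toBasis hι]
    exact he.2 i j hij
  have hc : ∀ i, g.val x (he.toBasis hι i) (he.toBasis hι i) ≠ 0 := fun i ↦ by
    rw [he.coe_toBasis hι, he.1 i]
    exact one_ne_zero
  rw [g.normSq_eq_sum_sq x (he.toBasis hι) hO hc (g.ricci x), ricciNormSqFrame, Finset.sum_comm]
  simp only [he.coe_toBasis hι, he.1, mul_one, div_one]

omit [FiniteDimensional ℝ E] [g.HasLeviCivita] in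
/-- Linearity of `Rm_x = curvatureForm` in each slot, as `IsLinearMap`s. [folklore] -/
theorem _root_.Literature.Geometry.Lorentzian.PseudoRiemannianMetric.isLinearMap_curvatureForm
    (cov : CovariantDerivative I E (TangentSpace I : M → Type _)) (x : M) :
    (∀ Y Z V : TangentSpace I x, IsLinearMap ℝ fun X ↦ g.curvatureForm cov x X Y Z V) ∧
    (∀ X Z V : TangentSpace I x, IsLinearMap ℝ fun Y ↦ g.curvatureForm cov x X Y Z V) ∧
    (∀ X Y V : TangentSpace I x, IsLinearMap ℝ fun Z ↦ g.curvatureForm cov x X Y Z V) ∧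
    (∀ X Y Z : TangentSpace I x, IsLinearMap ℝ fun V ↦ g.curvatureForm cov x X Y Z V) := by
  refine ⟨fun Y Z V ↦ ⟨fun X X' ↦ ?_, fun c X ↦ ?_⟩, fun X Z V ↦ ⟨fun Y Y' ↦ ?_, fun c Y ↦ ?_⟩,
    fun X Y V ↦ ⟨fun Z Z' ↦ ?_, fun c Z ↦ ?_⟩, fun X Y Z ↦ ⟨fun V V' ↦ ?_, fun c V ↦ ?_⟩⟩ <;>
  simp only [curvatureForm, map_add, map_smul, _root_.add_apply, _root_.smul_apply, smul_eq_mul]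

/-- **Frame independence of `Σ_{ijkl} Rm(eᵢ,eⱼ,e_k,e_l)²`** over orthonormal bases
(`sum_sq_fourLinear_eq_of_isOrthonormalFrame`). [folklore] -/
theorem _root_.Literature.Geometry.Lorentzian.PseudoRiemannianMetric.curvNormSqFrame_eq_of_isOrthonormalFrame
    {x : M} {ι ι' : Type*} [Fintype ι] [Fintype ι'] [DecidableEq ι] [DecidableEq ι']
    {e : ι → TangentSpace I x} (he : g.IsOrthonormalFrame x e) (hι : Fintype.card ι = finrank ℝ E)
    {e' : ι' → TangentSpace I x} (he' : g.IsOrthonormalFrame x e')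
    (hι' : Fintype.card ι' = finrank ℝ E) :
    g.curvNormSqFrame x e = g.curvNormSqFrame x e' := by
  obtain ⟨h₁, h₂, h₃, h₄⟩ := g.isLinearMap_curvatureForm g.leviCivita x
  have h := g.sum_sq_fourLinear_eq_of_isOrthonormalFrame (he.toBasis hι)
    (by rw [he.coe_toBasis hι]; exact he) (he'.toBasis hι') (by rw [he'.coe_toBasis hι']; exact he')
    (g.curvatureForm g.leviCivita x) h₁ h₂ h₃ h₄
  simpa only [curvNormSqFrame, he.coe_toBasis hι, he'.coe_toBasis hι'] using h

variable [CompleteSpace E] [I.Boundaryless]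

/-- **`Σ_{ijkl} Rm(eᵢ,eⱼ,e_k,e_l)² = |Rm|²_g(x)`**: in an orthonormal basis of a Riemannian
metric, the frame expression `curvNormSqFrame` is the intrinsic square norm `curvNormSqWith` of
`CurvatureNormSq.lean` (Topping 2006, (3.2.4)) — read in the chart at `x`, where the latter is
`rmNormSqAt` of the components (`curvNormSqWith_chartInv_eq'`), a sum of squares in any
orthonormal basis of the chart fibre (`rmNormSqAt_eq_sum_sq`, `chartRep_riemAt_eq_curvatureForm`).
[cite: Topping2006, §3.2, (3.2.4)] -/
theorem _root_.Literature.Geometry.Lorentzian.PseudoRiemannianMetric.curvNormSqFrame_eq_curvNormSqWith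
    (hg : g.IsRiemannian) {x : M} {ι : Type*} [Fintype ι] [DecidableEq ι]
    {e : ι → TangentSpace I x} (he : g.IsOrthonormalFrame x e) (hι : Fintype.card ι = finrank ℝ E) :
    g.curvNormSqFrame x e = g.curvNormSqWith g.leviCivita x := by
  classical
  have hLC : g.IsLeviCivita g.leviCivita := g.isLeviCivita_leviCivita_holds
  -- move the point to the form `chartInv I x y₀`
  suffices key : ∀ (y : chartTarget I x) (f : ι → TangentSpace I (chartInv I x y)),
      g.IsOrthonormalFrame (chartInv I x y) f →
        g.curvNormSqFrame (chartInv I x y) f = g.curvNormSqWith g.leviCivita (chartInv I x y) by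
    have hy₀ : extChartAt I x x ∈ (extChartAt I x).target := mem_extChartAt_target x
    have hΦ : chartInv I x ⟨extChartAt I x x, hy₀⟩ = x := extChartAt_to_inv x
    revert e
    rw [← hΦ]
    intro e he
    exact key _ e he
  intro y f hf
  rw [curvNormSqWith_chartInv_eq' hLC x y]
  -- an orthonormal basis of the chart fibre and the corresponding frame of `T_{Φ y} M`
  have hGm := isMetricOn_chartRep_const g x
  obtain ⟨b, hb⟩ := MetricCoord.exists_orthonormal_basis (chartRep_const_symm x y)
    (chartRep_const_pos hg x y)
  set L := mfderiv 𝓘(ℝ, E) I (chartInv I x) y with hL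
  have hLf : g.IsOrthonormalFrame (chartInv I x y) (fun i ↦ L (b i)) := by
    refine ⟨fun i ↦ ?_, fun i j hij ↦ ?_⟩
    · have := hb i i
      rw [if_pos rfl, chartRep_apply] at this
      exact this
    · have := hb i j
      rw [if_neg hij, chartRep_apply] at this
      exact this
  rw [hGm.rmNormSqAt_eq_sum_sq b hb y.2]
  simp only [chartRep_riemAt_eq_curvatureForm hLC x y]
  have hcard : Fintype.card (Fin (finrank ℝ E)) = finrank ℝ E := Fintype.card_fin _
  rw [g.curvNormSqFrame_eq_of_isOrthonormalFrame hf hι hLf hcard, curvNormSqFrame]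

/-- **`|Rm|²_g` is continuous** for a `C^∞` metric with its Levi-Civita connection: on each
chart domain it is the smooth coordinate function `rmNormSqAt` of the components
(`IsMetricOn.contDiffOn_rmNormSqAt`) composed with the chart. [cite: Topping2006, §3.2, (3.2.4)] -/
theorem _root_.Literature.Geometry.Lorentzian.PseudoRiemannianMetric.continuous_curvNormSqWith :
    Continuous fun x ↦ g.curvNormSqWith g.leviCivita x := by
  have hLC : g.IsLeviCivita g.leviCivita := g.isLeviCivita_leviCivita_holds
  refine continuous_iff_continuousAt.2 fun x₀ ↦ ?_
  have hy₀ : extChartAt I x₀ x₀ ∈ (extChartAt I x₀).target := mem_extChartAt_target x₀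
  have hsrc : ∀ᶠ p in 𝓝 x₀, p ∈ (extChartAt I x₀).source :=
    (isOpen_extChartAt_source x₀).mem_nhds (mem_extChartAt_source x₀)
  have hc := (((isMetricOn_chartRep_const g x₀).contDiffOn_rmNormSqAt.continuousOn).continuousAt
    ((isOpen_extChartAt_target x₀).mem_nhds hy₀)).comp (continuousAt_extChartAt x₀)
  refine hc.congr ?_
  filter_upwards [hsrc] with p hp
  have hpy : extChartAt I x₀ p ∈ (extChartAt I x₀).target := (extChartAt I x₀).map_source hp
  have h := curvNormSqWith_chartInv_eq' hLC x₀ ⟨extChartAt I x₀ p, hpy⟩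
  have hinv : chartInv I x₀ ⟨extChartAt I x₀ p, hpy⟩ = p := (extChartAt I x₀).left_inv hp
  rw [hinv] at h
  exact h.symm

variable {g}

/-- **`|W_g|²(x)` through intrinsic quantities** on a `4`-dimensional model, for a Riemannian
`C^∞` metric: `|W|² = |Rm|² − 2|Ric|² + S²/3` with `|Rm|² = curvNormSqWith`,
`|Ric|² = normSq Ric` (Besse 1987, (1.116)–1.117; `weylNormSqFrame_eq_curvNormSqFrame` in an
orthonormal basis). [cite: Besse1987, (1.116)–1.117] -/
theorem _root_.Literature.Geometry.Lorentzian.PseudoRiemannianMetric.weylNormSq_eq_curvNormSqWith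
    (hg : g.IsRiemannian) (hE : finrank ℝ E = 4) (x : M) :
    g.weylNormSq x = g.curvNormSqWith g.leviCivita x - 2 * g.normSq x (g.ricci x) +
      g.scalarCurvature x ^ 2 / 3 := by
  obtain ⟨b, hb⟩ := g.exists_basis_isOrthonormalFrame (x := x) (fun v hv ↦ hg x v hv) hE
  rw [g.weylNormSq_eq_weylNormSqFrame_four hE hb,
    g.weylNormSqFrame_eq_curvNormSqFrame (WithTop.coe_le_coe.mpr le_top) hE hb,
    g.curvNormSqFrame_eq_curvNormSqWith hg hb (by rw [Fintype.card_fin, hE]),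
    g.ricciNormSqFrame_eq_normSq hb (by rw [Fintype.card_fin, hE])]

omit [CompleteSpace E] [I.Boundaryless] in
/-- **`|E_g|²(x)` through intrinsic quantities** on a `4`-dimensional model, for a Riemannian
`C^∞` metric: `|E|² = |Ric|² − S²/4` (`ricciNormSqFrame_eq` in an orthonormal basis).
[cite: ChangGurskyYang2003, (0.2)] -/
theorem _root_.Literature.Geometry.Lorentzian.PseudoRiemannianMetric.tracelessRicciNormSq_eq_normSq
    (hg : g.IsRiemannian) (hE : finrank ℝ E = 4) (x : M) :
    g.tracelessRicciNormSq x = g.normSq x (g.ricci x) - g.scalarCurvature x ^ 2 / 4 := by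
  obtain ⟨b, hb⟩ := g.exists_basis_isOrthonormalFrame (x := x) (fun v hv ↦ hg x v hv) hE
  rw [g.tracelessRicciNormSq_eq_tracelessRicciNormSqFrame_four hE hb,
    ← g.ricciNormSqFrame_eq_normSq hb (by rw [Fintype.card_fin, hE]),
    g.ricciNormSqFrame_eq x b (hb.sum_ricci_eq_scalarCurvature g hE)]
  ring

variable (g)

omit [I.Boundaryless] in
/-- **`|E_g|²` is continuous** (indeed `|Ric|²_g − S²/4` with both terms `C^∞`,
`contMDiff_normSq_ricci'`, `contMDiff_scalarCurvature`), for a Riemannian `C^∞` metric on a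
`4`-dimensional model. [cite: ChangGurskyYang2003, (0.2)] -/
theorem _root_.Literature.Geometry.Lorentzian.PseudoRiemannianMetric.continuous_tracelessRicciNormSq
    (hg : g.IsRiemannian) (hE : finrank ℝ E = 4) : Continuous g.tracelessRicciNormSq := by
  have h : g.tracelessRicciNormSq = fun x ↦ g.normSq x (g.ricci x) - g.scalarCurvature x ^ 2 / 4 :=
    funext fun x ↦ g.tracelessRicciNormSq_eq_normSq hg hE x
  rw [h]
  exact (g.contMDiff_normSq_ricci').continuous.sub
    ((g.contMDiff_scalarCurvature.continuous.pow 2).div_const _)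

/-- **`|W_g|²` is continuous** (`|Rm|² − 2|Ric|² + S²/3`, each term continuous), for a
Riemannian `C^∞` metric on a `4`-dimensional model — the regularity deferred in
`WeylEnergy.lean` ("continuity of `|W|²` … not proved here"). [cite: Besse1987, (1.116)–1.117] -/
theorem _root_.Literature.Geometry.Lorentzian.PseudoRiemannianMetric.continuous_weylNormSq
    (hg : g.IsRiemannian) (hE : finrank ℝ E = 4) : Continuous g.weylNormSq := by
  have h : g.weylNormSq = fun x ↦ g.curvNormSqWith g.leviCivita x - 2 * g.normSq x (g.ricci x) +
      g.scalarCurvature x ^ 2 / 3 := funext fun x ↦ g.weylNormSq_eq_curvNormSqWith hg hE x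
  rw [h]
  exact ((g.continuous_curvNormSqWith).sub
    (continuous_const.mul (g.contMDiff_normSq_ricci').continuous)).add
    ((g.contMDiff_scalarCurvature.continuous.pow 2).div_const _)

omit [I.Boundaryless] in
/-- **`σ₂(A_g)` is continuous** (`−½|E|² + S²/24`), for a Riemannian `C^∞` metric on a
`4`-dimensional model. [cite: ChangGurskyYang2003, §1, (1.0)–(1.1)] -/
theorem _root_.Literature.Geometry.Lorentzian.PseudoRiemannianMetric.continuous_sigma2WeylSchouten
    (hg : g.IsRiemannian) (hE : finrank ℝ E = 4) : Continuous g.sigma2WeylSchouten := by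
  have h : g.sigma2WeylSchouten = fun x ↦
      -(1 / 2) * g.tracelessRicciNormSq x + g.scalarCurvature x ^ 2 / 24 :=
    funext fun x ↦ g.sigma2WeylSchouten_eq (WithTop.coe_le_coe.mpr le_top) hE (fun v hv ↦ hg x v hv)
  rw [h]
  exact (continuous_const.mul (g.continuous_tracelessRicciNormSq hg hE)).add
    ((g.contMDiff_scalarCurvature.continuous.pow 2).div_const _)

/-! #### Consequences on closed manifolds: the Weyl energy and `∫σ₂(A) dV` are honest integrals -/

/-- **`∫|W|² dV` as a real integral**: on a compact Hausdorff `4`-manifold with a `C^∞`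
Riemannian metric, `g.weylEnergy = ENNReal.ofReal (∫ |W_g|² dV_g)` with `|W|²` integrable
(continuous on a compact space, finite Riemannian volume). [cite: ChangGurskyYang2003, Thm. A, (0.3)] -/
theorem _root_.Literature.Geometry.Lorentzian.PseudoRiemannianMetric.weylEnergy_eq_ofReal_integral
    [T2Space M] [CompactSpace M] [T3Space M] [MeasurableSpace M] [BorelSpace M]
    (hg : g.IsRiemannian) (hE : finrank ℝ E = 4) :
    Integrable g.weylNormSq (riemannianMeasure (g.toContMDiffRiemannianMetric hg)) ∧
    g.weylEnergy = ENNReal.ofReal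
      (∫ x, g.weylNormSq x ∂(riemannianMeasure (g.toContMDiffRiemannianMetric hg))) := by
  haveI : IsFiniteMeasure (riemannianMeasure (g.toContMDiffRiemannianMetric hg)) :=
    ⟨riemannianVolume_lt_top_of_isCompact_holds (g.toContMDiffRiemannianMetric hg) le_rfl
      isCompact_univ⟩
  have hc := g.continuous_weylNormSq hg hE
  obtain ⟨C, hC⟩ := isCompact_univ.exists_bound_of_continuousOn hc.continuousOn
  have hint : Integrable g.weylNormSq (riemannianMeasure (g.toContMDiffRiemannianMetric hg)) :=
    (memLp_top_of_bound hc.aestronglyMeasurable C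
      (ae_of_all _ fun x ↦ hC x (mem_univ x))).integrable le_top
  refine ⟨hint, ?_⟩
  rw [g.weylEnergy_eq hg, ← ofReal_integral_eq_lintegral_ofReal hint
    (ae_of_all _ fun x ↦ g.weylNormSq_nonneg x)]

omit [I.Boundaryless] in
/-- **`∫σ₂(A) dV` is an honest integral**: `σ₂(A_g)` is integrable on a compact Hausdorff
`4`-manifold with a `C^∞` Riemannian metric, and `g.sigma2WeylSchoutenIntegral` is its Bochner
integral (`sigma2WeylSchoutenIntegral_eq`). [cite: ChangGurskyYang2003, §1, (1.1)–(1.2)] -/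
theorem _root_.Literature.Geometry.Lorentzian.PseudoRiemannianMetric.integrable_sigma2WeylSchouten
    [T2Space M] [CompactSpace M] [T3Space M] [MeasurableSpace M] [BorelSpace M]
    (hg : g.IsRiemannian) (hE : finrank ℝ E = 4) :
    Integrable g.sigma2WeylSchouten (riemannianMeasure (g.toContMDiffRiemannianMetric hg)) := by
  haveI : IsFiniteMeasure (riemannianMeasure (g.toContMDiffRiemannianMetric hg)) :=
    ⟨riemannianVolume_lt_top_of_isCompact_holds (g.toContMDiffRiemannianMetric hg) le_rfl
      isCompact_univ⟩
  have hc := g.continuous_sigma2WeylSchouten hg hE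
  obtain ⟨C, hC⟩ := isCompact_univ.exists_bound_of_continuousOn hc.continuousOn
  exact (memLp_top_of_bound hc.aestronglyMeasurable C
    (ae_of_all _ fun x ↦ hC x (mem_univ x))).integrable le_top

/-- **(1.2) as printed**: on a compact Hausdorff `4`-manifold with a `C^∞` Riemannian metric,
`¼ (∫|W|² dV).toReal < ∫σ₂(A) dV ↔ 0 < ∫ (σ₂(A) − ¼|W|²) dV` — the hypothesis (ii) of Thm. 1.4 /
(1.2) of Chang–Gursky–Yang 2003 in the shape used by `hThm14`, versus the single integral of the
paper. [cite: ChangGurskyYang2003, §1, (1.2)] -/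
theorem _root_.Literature.Geometry.Lorentzian.PseudoRiemannianMetric.quarter_weylEnergy_lt_sigma2WeylSchoutenIntegral_iff
    [T2Space M] [CompactSpace M] [T3Space M] [MeasurableSpace M] [BorelSpace M]
    (hg : g.IsRiemannian) (hE : finrank ℝ E = 4) :
    1 / 4 * g.weylEnergy.toReal < g.sigma2WeylSchoutenIntegral ↔
      0 < ∫ x, (g.sigma2WeylSchouten x - 1 / 4 * g.weylNormSq x)
        ∂(riemannianMeasure (g.toContMDiffRiemannianMetric hg)) := by
  obtain ⟨hW, hWE⟩ := g.weylEnergy_eq_ofReal_integral hg hE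
  have hσ := g.integrable_sigma2WeylSchouten hg hE
  rw [hWE, ENNReal.toReal_ofReal (integral_nonneg fun x ↦ g.weylNormSq_nonneg x),
    g.sigma2WeylSchoutenIntegral_eq hg, integral_sub hσ (hW.const_mul _), integral_const_mul]
  constructor <;> intro h <;> linarith

end Regularity

end Literature.Geometry.Riemannian

end
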